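import Literature.NumberTheory.EllipticCurves.EtaQuotientQExpansionProofs
import Mathlib.NumberTheory.Padics.RingHoms
import HarnessLib

/-!
# Even-supported power series and the «`q² ↦ q`» contraction (lemmas for the even-scale half of E-an-49⁺)

Summit `BirchSwinnertonDyer`, route `ManinLocalTwoThree` (cell bsd-f2-manin), crux C2 `ManinOddAtFour` (stmt-BirchSwinnertonDyer-22967),
stub `stub_minimalReducibleResidual` (Rb); an g14's E-an-49⁺ `EtaUnitSquareIffEven` (MEMO-an §56.3), even-scale descent
«`g = s²·F(q²)`, `F(q²) ∈ (ℤ₂⟦q⟧)² ⇔ F ∈ (ℤ₂⟦q⟧)²`».  Plumbing only, over a commutative ring `R` (no new definitions — the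
contraction `F(q²) ↦ F` is written `PowerSeries.mk fun m => coeff (2*m) f` in place):

* `oddVanish_mul/pow/prod` — series with no odd-degree terms are closed under products;
* `contract_mul/pow/prod/map` — on such series the contraction `q² ↦ q` is multiplicative and commutes with `map`;
* `contract_formalEulerScaled_two_mul` — `E(q^{2δ})` contracts to `E(q^δ)`; `oddVanish_formalEulerScaled_of_even`;
* `oddVanish_of_mul_eq` — if `Φ·A = B` with `A`, `B` free of odd terms and `A(0) = 1`, then so is `Φ`;
* `oddVanish_of_sq_oddVanish` — over a domain of characteristic `0`: if `H²` has no odd terms and `H(0) ≠ 0`, neither has `H`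
  (uniqueness of the square root), whence `isSquare_contract_of_isSquare`.

Nothing about BSD or Manin's conjecture is proved here.

References: cell memo HOME/MEMO-an.md §56.3; T. M. Apostol, GTM 41 §3.1–§3.2 [cite: Apostol1990, §3.1–§3.2].
-/

set_option autoImplicit false
set_option linter.dupNamespace false

open PowerSeries Literature.NumberTheory.EllipticCurves.ModularForms

namespace Summit.BirchSwinnertonDyer.BirchSwinnertonDyer.Theorems.ManinLocalTwoThree

noncomputable section

section General

variable {R : Type*} [CommRing R]

/-- Products of series without odd-degree terms have no odd-degree terms. [folklore] -/
theorem oddVanish_mul {f g : PowerSeries R} (hf : ∀ i, Odd i → coeff i f = 0) (hg : ∀ i, Odd i → coeff i g = 0) :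
    ∀ i, Odd i → coeff i (f * g) = 0 := by
  intro i hi
  rw [coeff_mul]
  refine Finset.sum_eq_zero fun p hp => ?_
  rw [Finset.mem_antidiagonal] at hp
  rcases Nat.even_or_odd p.1 with h1 | h1
  · have h2 : Odd p.2 := by
      rcases Nat.even_or_odd p.2 with h2 | h2
      · exfalso; rw [← hp] at hi; exact (Nat.not_even_iff_odd.mpr hi) (h1.add h2)
      · exact h2
    rw [hg p.2 h2, mul_zero]
  · rw [hf p.1 h1, zero_mul]

/-- Powers of a series without odd-degree terms have none. [folklore] -/
theorem oddVanish_pow {f : PowerSeries R} (hf : ∀ i, Odd i → coeff i f = 0) (n : ℕ) : ∀ i, Odd i → coeff i (f ^ n) = 0 := by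
  induction n with
  | zero => intro i hi; rw [pow_zero, coeff_one, if_neg (Nat.pos_iff_ne_zero.mp hi.pos)]
  | succ n ih => rw [pow_succ]; exact oddVanish_mul ih hf

/-- Finite products of series without odd-degree terms have none. [folklore] -/
theorem oddVanish_prod {ι : Type*} (s : Finset ι) (F : ι → PowerSeries R) (hF : ∀ j ∈ s, ∀ i, Odd i → coeff i (F j) = 0) :
    ∀ i, Odd i → coeff i (∏ j ∈ s, F j) = 0 := by
  classical
  induction s using Finset.induction_on with
  | empty => intro i hi; rw [Finset.prod_empty, coeff_one, if_neg (Nat.pos_iff_ne_zero.mp hi.pos)]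
  | insert a s ha ih =>
    rw [Finset.prod_insert ha]
    exact oddVanish_mul (hF a (Finset.mem_insert_self a s)) (ih fun j hj => hF j (Finset.mem_insert_of_mem hj))

/-- **The contraction `q² ↦ q` is multiplicative on series without odd-degree terms.** [folklore] -/
theorem contract_mul {f g : PowerSeries R} (hf : ∀ i, Odd i → coeff i f = 0) :
    (PowerSeries.mk fun m => coeff (2 * m) (f * g)) =
      (PowerSeries.mk fun m => coeff (2 * m) f) * (PowerSeries.mk fun m => coeff (2 * m) g) := by
  ext m
  simp only [coeff_mk, coeff_mul]
  -- drop the (vanishing) terms with odd first index, then reindex by `(a,b) ↦ (2a,2b)`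
  have hsub : ∑ p ∈ Finset.antidiagonal (2 * m), coeff p.1 f * coeff p.2 g =
      ∑ p ∈ (Finset.antidiagonal (2 * m)).filter (fun p => 2 ∣ p.1), coeff p.1 f * coeff p.2 g := by
    rw [Finset.sum_filter]
    refine Finset.sum_congr rfl fun p _ => ?_
    split_ifs with h
    · rfl
    · rw [hf p.1 (Nat.odd_iff.mpr (by omega)), zero_mul]
  have himg : (Finset.antidiagonal (2 * m)).filter (fun p => 2 ∣ p.1) =
      (Finset.antidiagonal m).image (fun q => (2 * q.1, 2 * q.2)) := by
    ext p
    simp only [Finset.mem_filter, Finset.mem_antidiagonal, Finset.mem_image, Prod.ext_iff]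
    constructor
    · rintro ⟨hsum, hdvd⟩
      exact ⟨(p.1 / 2, p.2 / 2), by omega, by omega, by omega⟩
    · rintro ⟨q, hq, h1, h2⟩
      omega
  rw [hsub, himg, Finset.sum_image]
  rintro q₁ - q₂ - h
  simp only [Prod.ext_iff] at h
  exact Prod.ext (by omega) (by omega)

/-- The contraction of `1` is `1`. [folklore] -/
theorem contract_one : (PowerSeries.mk fun m => coeff (2 * m) (1 : PowerSeries R)) = 1 := by
  ext m
  rw [coeff_mk, coeff_one, coeff_one]
  by_cases hm : m = 0
  · subst hm; simp
  · rw [if_neg (by omega), if_neg hm]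

/-- The contraction is multiplicative on powers of a series without odd-degree terms. [folklore] -/
theorem contract_pow {f : PowerSeries R} (hf : ∀ i, Odd i → coeff i f = 0) (n : ℕ) :
    (PowerSeries.mk fun m => coeff (2 * m) (f ^ n)) = (PowerSeries.mk fun m => coeff (2 * m) f) ^ n := by
  induction n with
  | zero => rw [pow_zero, pow_zero]; exact contract_one
  | succ n ih => rw [pow_succ, pow_succ, contract_mul (oddVanish_pow hf n), ih]

/-- The contraction is multiplicative on finite products of series without odd-degree terms. [folklore] -/
theorem contract_prod {ι : Type*} (s : Finset ι) (F : ι → PowerSeries R) (hF : ∀ j ∈ s, ∀ i, Odd i → coeff i (F j) = 0) :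
    (PowerSeries.mk fun m => coeff (2 * m) (∏ j ∈ s, F j)) = ∏ j ∈ s, PowerSeries.mk fun m => coeff (2 * m) (F j) := by
  classical
  induction s using Finset.induction_on with
  | empty => rw [Finset.prod_empty, Finset.prod_empty]; exact contract_one
  | insert a s ha ih =>
    rw [Finset.prod_insert ha, Finset.prod_insert ha, contract_mul (hF a (Finset.mem_insert_self a s)),
      ih fun j hj => hF j (Finset.mem_insert_of_mem hj)]

/-- The contraction commutes with coefficientwise maps. [folklore] -/
theorem contract_map {S : Type*} [CommRing S] (φ : R →+* S) (f : PowerSeries R) :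
    (PowerSeries.mk fun m => coeff (2 * m) (f.map φ)) = (PowerSeries.mk fun m => coeff (2 * m) f).map φ := by
  ext m
  rw [coeff_mk, coeff_map, coeff_map, coeff_mk]

/-- Coefficientwise maps preserve the absence of odd-degree terms. [folklore] -/
theorem oddVanish_map {S : Type*} [CommRing S] (φ : R →+* S) {f : PowerSeries R} (hf : ∀ i, Odd i → coeff i f = 0) :
    ∀ i, Odd i → coeff i (f.map φ) = 0 := fun i hi => by rw [coeff_map, hf i hi, map_zero]

/-- **If `Φ · A = B` where `A`, `B` have no odd-degree terms and `A(0) = 1`, then `Φ` has no odd-degree terms** (look at the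
least odd degree of `Φ`). [folklore] -/
theorem oddVanish_of_mul_eq {Φ A B : PowerSeries R} (hA : ∀ i, Odd i → coeff i A = 0) (hA0 : constantCoeff A = 1)
    (hB : ∀ i, Odd i → coeff i B = 0) (h : Φ * A = B) : ∀ i, Odd i → coeff i Φ = 0 := by
  by_contra hne
  push Not at hne
  classical
  -- least odd degree carrying a non-zero coefficient of `Φ`
  let m := Nat.find hne
  obtain ⟨hm_odd, hm_ne⟩ : Odd m ∧ coeff m Φ ≠ 0 := Nat.find_spec hne
  have hmin : ∀ i, i < m → Odd i → coeff i Φ = 0 := fun i hi hio => by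
    by_contra hc; exact Nat.find_min hne hi ⟨hio, hc⟩
  have hcm : coeff m (Φ * A) = coeff m Φ := by
    rw [coeff_mul, Finset.sum_eq_single (⟨m, 0⟩ : ℕ × ℕ)]
    · rw [coeff_zero_eq_constantCoeff, hA0, mul_one]
    · intro p hp hpm
      rw [Finset.mem_antidiagonal] at hp
      rcases Nat.even_or_odd p.2 with h2 | h2
      · -- then `p.1` is odd and `< m` (as `p ≠ (m, 0)` forces `p.2 ≠ 0`)
        have h1 : Odd p.1 := by
          rcases Nat.even_or_odd p.1 with h1 | h1
          · exfalso; rw [← hp] at hm_odd; exact (Nat.not_even_iff_odd.mpr hm_odd) (h1.add h2)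
          · exact h1
        have hlt : p.1 < m := by
          rcases Nat.lt_or_ge p.1 m with hl | hl
          · exact hl
          · exfalso; apply hpm; exact Prod.ext (by omega) (by omega)
        rw [hmin p.1 hlt h1, zero_mul]
      · rw [hA p.2 h2, mul_zero]
    · intro hnot; exfalso; exact hnot (by simp)
  rw [h, hB m hm_odd] at hcm
  exact hm_ne hcm.symm

/-- **Uniqueness of the square root on even-supported series**: over a domain of characteristic `0`, if `H²` has no odd-degree
terms and `H(0) ≠ 0` then `H` has no odd-degree terms (the least odd coefficient `H_m` would give `(H²)_m = 2 H_0 H_m ≠ 0`). [folklore] -/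
theorem oddVanish_of_sq_oddVanish [IsDomain R] [CharZero R] {H : PowerSeries R} (hH : ∀ i, Odd i → coeff i (H * H) = 0)
    (hH0 : constantCoeff H ≠ 0) : ∀ i, Odd i → coeff i H = 0 := by
  by_contra hne
  push Not at hne
  classical
  let m := Nat.find hne
  obtain ⟨hm_odd, hm_ne⟩ : Odd m ∧ coeff m H ≠ 0 := Nat.find_spec hne
  have hmin : ∀ i, i < m → Odd i → coeff i H = 0 := fun i hi hio => by
    by_contra hc; exact Nat.find_min hne hi ⟨hio, hc⟩
  have hm0 : m ≠ 0 := Nat.pos_iff_ne_zero.mp hm_odd.pos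
  have hcm : coeff m (H * H) = 2 * (constantCoeff H * coeff m H) := by
    rw [coeff_mul, Finset.sum_eq_add_of_mem (⟨m, 0⟩ : ℕ × ℕ) (⟨0, m⟩ : ℕ × ℕ) (by simp) (by simp)
      (by intro h'; have := congrArg Prod.fst h'; simp at this; exact hm0 this)]
    · simp only [coeff_zero_eq_constantCoeff]; ring
    · intro p hp hpne
      obtain ⟨hp1, hp2⟩ := hpne
      rw [Finset.mem_antidiagonal] at hp
      rcases Nat.even_or_odd p.1 with h1 | h1
      · have h2 : Odd p.2 := by
          rcases Nat.even_or_odd p.2 with h2 | h2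
          · exfalso; rw [← hp] at hm_odd; exact (Nat.not_even_iff_odd.mpr hm_odd) (h1.add h2)
          · exact h2
        have hlt : p.2 < m := by
          rcases Nat.lt_or_ge p.2 m with hl | hl
          · exact hl
          · exfalso; apply hp2; exact Prod.ext (by omega) (by omega)
        rw [hmin p.2 hlt h2, mul_zero]
      · have hlt : p.1 < m := by
          rcases Nat.lt_or_ge p.1 m with hl | hl
          · exact hl
          · exfalso; apply hp1; exact Prod.ext (by omega) (by omega)
        rw [hmin p.1 hlt h1, zero_mul]
  rw [hH m hm_odd] at hcm
  have : (2 : R) * (constantCoeff H * coeff m H) ≠ 0 := mul_ne_zero two_ne_zero (mul_ne_zero hH0 hm_ne)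
  exact this hcm.symm

/-- **A square without odd-degree terms contracts to a square** (domain of characteristic `0`, constant term `1`). [folklore] -/
theorem isSquare_contract_of_isSquare [IsDomain R] [CharZero R] {f : PowerSeries R} (hf : ∀ i, Odd i → coeff i f = 0)
    (hf0 : constantCoeff f = 1) (hsq : IsSquare f) : IsSquare (PowerSeries.mk fun m => coeff (2 * m) f) := by
  obtain ⟨H, rfl⟩ := hsq
  have hH0 : constantCoeff H ≠ 0 := by
    intro h0; rw [map_mul, h0, mul_zero] at hf0; exact zero_ne_one hf0
  have hH := oddVanish_of_sq_oddVanish hf hH0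
  exact ⟨PowerSeries.mk fun m => coeff (2 * m) H, contract_mul hH⟩

end General

/-! ### The Euler factors -/

section Euler

/-- `E(q^δ)` has no odd-degree terms for even `δ`. [folklore] -/
theorem oddVanish_formalEulerScaled_of_even {δ : ℕ} (hδ : Even δ) : ∀ i, Odd i → coeff i (formalEulerScaled δ) = 0 := by
  intro i hi
  rw [coeff_formalEulerScaled, if_neg]
  intro hd
  exact (Nat.not_even_iff_odd.mpr hi) (even_iff_two_dvd.mpr ((even_iff_two_dvd.mp hδ).trans hd))

/-- **`E(q^{2δ})` contracts to `E(q^δ)`.** [folklore] -/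
theorem contract_formalEulerScaled_two_mul (δ : ℕ) :
    (PowerSeries.mk fun m => coeff (2 * m) (formalEulerScaled (2 * δ))) = formalEulerScaled δ := by
  ext m
  rw [coeff_mk, coeff_formalEulerScaled, coeff_formalEulerScaled]
  by_cases h : δ ∣ m
  · rw [if_pos (Nat.mul_dvd_mul_left 2 h), if_pos h, Nat.mul_div_mul_left _ _ (by norm_num)]
  · rw [if_neg, if_neg h]
    intro h2; exact h (Nat.dvd_of_mul_dvd_mul_left (by norm_num) h2)

end Euler



end

end Summit.BirchSwinnertonDyer.BirchSwinnertonDyer.Theorems.ManinLocalTwoThree
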